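import Mathlib

/-!
# R20 — continued-fraction (Euclid) towers over degenerate edges: the kernel-checkable core

res-L1-w45b-idea-1 g29 · card `Ideas/toric-towers.md` ROUND 20 · memo `R20-CONTINUED-FRACTION-TOWERS.md`.
OURS, counted 0, AI-written (weaker than expert review); nothing here is attributed to Hironaka; nothing of
`EquisingularLiftNatThree` is proved by this file.  Elementary combinatorics (`decide`, `omega`, `simp`) and
polynomial identities (`ring`) only.

## Part A — the Euclid tower `T(μ, ν)` of the plane germ `u^μ + A·t^ν` (A a unit), `t = 0` exceptional

Enriques' theorem (Casas-Alvero, *Singularities of Plane Curves*, Thm 5.2.2) describes the multiple infinitely near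
points of a branch through the Euclidean divisions of `(ν, μ)`; free points come first, satellites after.  In the R19/R20
dictionary a FREE multiple point over a generic point of the curve `Γ ⊂ E_v` is a hosted-section round `(HR)` (centre
`E_{C_k} ∩ St W`), a SATELLITE multiple point is a PAIR round (centre `E ∩ E'`).  `towerF` is the fuelled recursion
(structural in the fuel, so that `decide` evaluates it); `euclidTower μ ν` feeds fuel `μ + ν`, which suffices.

* `towerF_two`   : `T(2, ν) = S^{⌊ν/2⌋}`                      (the R19 law `⌊ν/2⌋`, all sections);
* `towerF_three` : `T(3, ν) = S^{⌊ν/3⌋} · (S₂ if ν ≡ 2 mod 3)` — length `⌊ν/3⌋ + [ν mod 3 = 2]`, ALL SECTIONS, no pair;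
* `euclidTower_four_six` : `T(4,6) = S₄ S₂ P₂` — the first pair inside a tower appears at `μ = 4`;
* `tower_two_zk`, `tower_three_zk`, `towers_unbounded` : the `z^k` families have tower height `k - 6` (μ = 2, ν = 2k-12)
  resp. unbounded height for μ = 3 (ν = 2k-18) — crit-3 TRIAGE-r51-3 sharpen A2 ("#(HR) per Γ̄ is unbounded") as a
  one-line corollary;
* `wordLength` : the ORDER-FREE word-length bookkeeping `1 + #pairs + Σ_v |T(μ_v, ν_v)|` with the customers of record
  (N7 = 10, N8 = 9, C12b = 8, C11a = 11 predicted).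

## Part B — the cubed umbrella customer `C12b = (x²+y²z)³ + x⁸ + y¹² + z¹² + x·y¹¹` in the chart `⟨E₁, E₅, E₂⟩`

`E₁ = (2,1,1)`, `E₅ = (2,1,2)`, `E₂ = (3,2,2)` (unimodular), monomial map `x = a²b²c³, y = abc², z = ab²c²`
(`a = t_{E₁}, b = t_{E₅}, c = t_{E₂}`).  The total transform is `a⁹ b¹² c¹⁸ · G`, and `G|_{E₂} = (a+1)³`: the exceptional
divisor `E₂ = E_{(3,2,2)}` meets the strict transform in the TRIPLED curve `Γ̄ = {a = -1}` (transversal type `u³ + A t⁶`,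
`ν = 6`).  Blowing up `Γ` (`a + 1 = u₁ c`) gives `G₁` with `G₁|_{E_Γ} = u₁³` — the new exceptional divisor again meets the
strict transform in a tripled curve `Γ₁` (the NESTED hosted section) — and blowing up `Γ₁` (`u₁ = u₂ c`) gives `G₂` with
`G₂|_{E_{Γ₁}} = u₂³ - (1 + b⁴ + b¹²)`, a reduced curve: the tower over `Γ` is `S₃ S₃ = T(3,6)`, two curve rounds, no pair,
no point — the kernel form of the R20 prediction "C12b closes in 1 + 5 + 2 = 8".

## Part C — the quartic customer `Q16b = (x²+y²z)⁴ + x¹⁰ + y¹⁶ + z¹⁶ + x·y¹⁵`: the first PAIR inside a tower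

Same chart; three rounds `S₄ S₂ P₂ = T(4,6)`: the third centre `C₃ = E_{C₂} ∩ St(E_{C₁})` lies on two (HR)-born exceptional members
(`H₂_on_EC₂`, `H₂_on_EC₁`) — a satellite point of the transversal germ `u⁴ + b⁴t⁶` — and after it the exceptional curve `u₃² + b⁴` is reduced
(`H₃_on_exc`) — but for `Q16b` the `t⁶`-coefficient `a⁸b⁴` dies at both closure points of `Γ̄`, leaving a secondary curve
(`H₃_secondary_curve`; kit j321689: the word continues `pair(E4,E7) · pair(E7,E9) …`).

## Part D — the closure-uniform quartic customer `Q16i = Q16b − x·y¹⁵ + x²y¹² + x²z¹²`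

`t⁶`-coefficient `a⁴(1 + b¹² + a⁴b⁴)`, a unit at both ends; same tower `S₄ S₂ P₂`, and `K₃_no_secondary_curve : K₃ 0 0 c₂ = 1`:
nothing survives over the closure point.  Word length `1 + 5 + 3 = 9` (`wordLength_Q16b`; R20c kit j321783: the twin `Q16j = Q16i − x¹⁰` closes in
exactly 9 with last move `pair(E_{C₁},E_{C₂})`; `Q16b` closes in `15 = 9 + |T(2,8)| + |T(2,4)|`, `wordLength_Q16b_with_ends`).
-/

set_option linter.dupNamespace false -- mandated namespace `Summit.<Summit>.<Problem>` of this single-conjunct summit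

namespace Summit.ResolutionOfSingularities.ResolutionOfSingularities.Cruxes.EquisingularLiftNatThree.ToricTowers.R20

/-! ## Part A — Euclid towers -/

/-- kind of a Γ-round: `S` = hosted section `(HR)` (free multiple point), `P` = pair of two exceptional members
(satellite multiple point). -/
inductive Rd | S | P
  deriving DecidableEq, Repr, Inhabited

/-- Fuelled Euclid tower of the plane germ `u^μ + A t^ν` (`A` a unit) at a point where the `t`-axis is exceptional and
the `u`-axis is exceptional iff `uExc`; returns the list of rounds `(kind, multiplicity of the centre)`.  One round per
MULTIPLE infinitely near point (multiplicity `min μ ν ≥ 2`); the recursion is the Euclidean algorithm on `(μ, ν)`: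
in the chart `u = u' t` the germ becomes `u'^μ + A t^{ν-μ}` (next point on the `u'`-axis: free iff the `u`-axis was not
exceptional), in the chart `t = t' u` it becomes `t'^ν · (…)`, i.e. `u^{μ-ν} + A⁻¹ t'^ν` up to a unit, with BOTH axes exceptional
(a satellite point). -/
def towerF : ℕ → ℕ → ℕ → Bool → List (Rd × ℕ)
  | 0, _, _, _ => []
  | n + 1, μ, ν, uExc =>
    if μ ≤ 1 ∨ ν ≤ 1 then []
    else ((if uExc then Rd.P else Rd.S), min μ ν) ::
      (if μ < ν then towerF n μ (ν - μ) uExc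
       else if ν < μ then towerF n (μ - ν) ν true
       else [])

/-- The Euclid tower `T(μ, ν)` over a GENERIC point of `Γ ⊂ E_v` (the host `E_v = {t = 0}` is exceptional, the
transversal coordinate `u` is not). -/
def euclidTower (μ ν : ℕ) : List (Rd × ℕ) := towerF (μ + ν) μ ν false

/-! ### the table of record (fan3 `euclid μ ν`), evaluated by the kernel -/

example : euclidTower 2 4 = [(Rd.S, 2), (Rd.S, 2)] := by decide
example : euclidTower 2 5 = [(Rd.S, 2), (Rd.S, 2)] := by decide
example : euclidTower 3 3 = [(Rd.S, 3)] := by decide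
example : euclidTower 3 4 = [(Rd.S, 3)] := by decide
example : euclidTower 3 5 = [(Rd.S, 3), (Rd.S, 2)] := by decide
example : euclidTower 3 6 = [(Rd.S, 3), (Rd.S, 3)] := by decide
example : euclidTower 3 7 = [(Rd.S, 3), (Rd.S, 3)] := by decide
example : euclidTower 3 8 = [(Rd.S, 3), (Rd.S, 3), (Rd.S, 2)] := by decide
/-- the first pair inside a tower: `μ = 4`, `ν = 6` (`u⁴ + t⁶`: O 4-fold, a free double point, then a satellite double
point). -/
theorem euclidTower_four_six : euclidTower 4 6 = [(Rd.S, 4), (Rd.S, 2), (Rd.P, 2)] := by decide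
example : euclidTower 4 7 = [(Rd.S, 4), (Rd.S, 3)] := by decide
example : euclidTower 5 7 = [(Rd.S, 5), (Rd.S, 2), (Rd.P, 2)] := by decide
example : euclidTower 5 8 = [(Rd.S, 5), (Rd.S, 3), (Rd.P, 2)] := by decide
example : euclidTower 4 10 = [(Rd.S, 4), (Rd.S, 4), (Rd.S, 2), (Rd.P, 2)] := by decide
example : euclidTower 6 9 = [(Rd.S, 6), (Rd.S, 3), (Rd.P, 3)] := by decide

theorem towerF_of_le_one (n μ ν : ℕ) (b : Bool) (h : μ ≤ 1 ∨ ν ≤ 1) : towerF n μ ν b = [] := by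
  cases n with
  | zero => rfl
  | succ n => simp [towerF, h]

/-- **μ = 2 (R19 law).**  `T(2, ν) = S₂^{⌊ν/2⌋}`. -/
theorem towerF_two (n ν : ℕ) (h : ν < n) : towerF n 2 ν false = List.replicate (ν / 2) (Rd.S, 2) := by
  induction n generalizing ν with
  | zero => omega
  | succ n ih =>
    rcases Nat.lt_or_ge ν 2 with hν | hν
    · have h1 : 2 ≤ 1 ∨ ν ≤ 1 := Or.inr (by omega)
      have h2 : ν / 2 = 0 := Nat.div_eq_of_lt hν
      rw [towerF_of_le_one _ _ _ _ h1, h2, List.replicate_zero]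
    · have h1 : ¬ (2 ≤ 1 ∨ ν ≤ 1) := by omega
      rcases Nat.eq_or_lt_of_le hν with hν2 | hν2
      · subst hν2
        simp [towerF]
      · have h3 : min 2 ν = 2 := Nat.min_eq_left (le_of_lt hν2)
        have h4 : ν / 2 = (ν - 2) / 2 + 1 := by omega
        simp only [towerF, h1, if_false, h3, hν2, if_true, Bool.false_eq_true]
        rw [ih (ν - 2) (by omega), h4, List.replicate_succ]

theorem euclidTower_two (ν : ℕ) : euclidTower 2 ν = List.replicate (ν / 2) (Rd.S, 2) :=
  towerF_two _ _ (by omega)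

theorem euclidTower_two_length (ν : ℕ) : (euclidTower 2 ν).length = ν / 2 := by
  rw [euclidTower_two, List.length_replicate]

/-- **μ = 3 (R20 law).**  `T(3, ν) = S₃^{⌊ν/3⌋} · (S₂ if ν ≡ 2 (mod 3))` — all rounds are hosted SECTIONS. -/
theorem towerF_three (n ν : ℕ) (h : ν < n) :
    towerF n 3 ν false = List.replicate (ν / 3) (Rd.S, 3) ++ (if ν % 3 = 2 then [(Rd.S, 2)] else []) := by
  induction n generalizing ν with
  | zero => omega
  | succ n ih =>
    rcases Nat.lt_or_ge ν 2 with hν | hν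
    · have h1 : 3 ≤ 1 ∨ ν ≤ 1 := Or.inr (by omega)
      have h2 : ν / 3 = 0 := Nat.div_eq_of_lt (by omega)
      have h3 : ¬ ν % 3 = 2 := by omega
      rw [towerF_of_le_one _ _ _ _ h1, h2, List.replicate_zero, if_neg h3, List.nil_append]
    · have h1 : ¬ (3 ≤ 1 ∨ ν ≤ 1) := by omega
      rcases Nat.eq_or_lt_of_le hν with hν2 | hν2
      · -- ν = 2 : one free double point `S₂`, then `towerF n 1 2 true = []`
        subst hν2
        have h5 : towerF n 1 2 true = [] := towerF_of_le_one _ _ _ _ (Or.inl le_rfl)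
        simp [towerF, h5]
      · rcases Nat.eq_or_lt_of_le (show 3 ≤ ν by omega) with hν3 | hν3
        · subst hν3
          simp [towerF]
        · have h3 : min 3 ν = 3 := Nat.min_eq_left (le_of_lt hν3)
          have h4 : ν / 3 = (ν - 3) / 3 + 1 := by omega
          have h6 : (ν - 3) % 3 = ν % 3 := by omega
          simp only [towerF, h1, if_false, h3, hν3, if_true, Bool.false_eq_true]
          rw [ih (ν - 3) (by omega), h4, List.replicate_succ, h6, List.cons_append]

theorem euclidTower_three (ν : ℕ) :
    euclidTower 3 ν = List.replicate (ν / 3) (Rd.S, 3) ++ (if ν % 3 = 2 then [(Rd.S, 2)] else []) :=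
  towerF_three _ _ (by omega)

/-- the R20 length law `|T(3, ν)| = ⌊ν/3⌋ + [ν mod 3 = 2]`. -/
theorem euclidTower_three_length (ν : ℕ) :
    (euclidTower 3 ν).length = ν / 3 + (if ν % 3 = 2 then 1 else 0) := by
  rw [euclidTower_three, List.length_append, List.length_replicate]
  split_ifs <;> simp

/-- μ = 3 towers consist of hosted SECTIONS only (no pair, unlike `μ = 4`, see `euclidTower_four_six`). -/
theorem euclidTower_three_all_sections (ν : ℕ) : ∀ r ∈ euclidTower 3 ν, r.1 = Rd.S := by
  intro r hr
  rw [euclidTower_three, List.mem_append] at hr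
  rcases hr with hr | hr
  · rw [List.mem_replicate] at hr
    rw [hr.2]
  · split_ifs at hr with h
    · rw [List.mem_singleton] at hr
      rw [hr]
    · simp at hr

/-! ### crit-3 TRIAGE-r51-3 sharpen A2: the number of `(HR)` rounds per `Γ̄` is unbounded (explicit `z^k` families)

μ = 2: `N_k = (x²+y⁴)² + … + z^k` has `ν_{(3,2,2)… }`-type edge order growing linearly: for the umbrella family of R19
(`(x²+y²z)² + tail + z^k`) the transversal order on `E_{(3,2,2)}` is `ν = 2k - 12` (`d_{(3,2,2)} = 12`, `ord z^k = 2k`),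
tower height `k - 6`.  μ = 3: the cubed family `(x²+y²z)³ + tail + z^k` has `d = 18`, `ν = 2k - 18`, height
`|T(3, 2k-18)|`, unbounded in `k`.  (The values of `ν` are the fan-calculus numbers of the memo; the statements below are
their arithmetic consequences.) -/

theorem tower_two_zk (k : ℕ) : (euclidTower 2 (2 * k - 12)).length = k - 6 := by
  rw [euclidTower_two_length]; omega

theorem tower_three_zk (k : ℕ) (hk : 9 ≤ k) : k / 3 - 3 ≤ (euclidTower 3 (2 * k - 18)).length := by
  rw [euclidTower_three_length]; split_ifs <;> omega

theorem towers_unbounded (B : ℕ) :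
    (∃ k, B < (euclidTower 2 (2 * k - 12)).length) ∧ (∃ k, B < (euclidTower 3 (2 * k - 18)).length) := by
  refine ⟨⟨B + 7, ?_⟩, ⟨3 * B + 12, ?_⟩⟩
  · rw [tower_two_zk]; omega
  · have := tower_three_zk (3 * B + 12) (by omega)
    omega

/-! ### order-free word-length bookkeeping -/

/-- predicted length of a P⁶ resolution word on a fibre-pair customer: the point step `P`, the toric PAIR rounds that
subdivide `Σ₀` to the closure of `N_τ`, and one Euclid tower per relint vertex `v` of `N_τ` with transversal type
`(μ, ν_v)` (special/closure points excluded — they are listed separately in the memo). -/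
def wordLength (pairs : ℕ) (towers : List (ℕ × ℕ)) : ℕ :=
  1 + pairs + (towers.map fun p => (euclidTower p.1 p.2).length).sum

/-- N7 (R19, kit j319418 ✓ 10 moves): 5 pairs, towers `T(2,4)` on `E_{(3,2,2)}` and `T(2,4)` on `E_{(2,1,2)}`. -/
example : wordLength 5 [(2, 4), (2, 4)] = 10 := by decide
/-- N8 (lead-1 by hand; fan.py R20 ✓ 9 moves): 5 pairs, `T(2,4)` on `E_{(3,2,2)}`, `T(2,3)` on `E_{(2,1,2)}`. -/
example : wordLength 5 [(2, 4), (2, 3)] = 9 := by decide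
/-- **C12b (R20 prediction, kit j321469): 5 pairs + `T(3,6) = S₃S₃` on `E_{(3,2,2)}` ⇒ 8.** -/
theorem wordLength_C12b : wordLength 5 [(3, 6)] = 8 := by decide
/-- C12c (R20 prediction): 5 pairs + `T(3,5) = S₃S₂` ⇒ 8 (+ special closure points). -/
example : wordLength 5 [(3, 5)] = 8 := by decide
/-- C11a (R20 prediction): 8 pairs + `T(3,4) = S₃` on `E_{(3,2,2)}` + `T(2,2)`-type… here `(3,2)`: `S₂` on `E_{(7,5,4)}` ⇒ 11. -/
example : wordLength 8 [(3, 4), (3, 2)] = 11 := by decide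

/-! ## Part B — C12b in the chart `⟨E₁, E₅, E₂⟩`: the tower `T(3,6) = S₃ S₃` as ring identities -/

section chart
variable {R : Type*} [CommRing R]

/-- the cubed umbrella customer `C12b` as a polynomial function -/
def C12b (x y z : R) : R := (x ^ 2 + y ^ 2 * z) ^ 3 + x ^ 8 + y ^ 12 + z ^ 12 + x * y ^ 11

/-- its strict transform in the chart `x = a²b²c³, y = abc², z = ab²c²` of the cone `⟨(2,1,1), (2,1,2), (3,2,2)⟩` -/
def G (a b c : R) : R := (a + 1) ^ 3 + c ^ 6 * (a ^ 7 * b ^ 4 + a ^ 3 + a ^ 3 * b ^ 12) + a ^ 4 * b * c ^ 7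

theorem C12b_chart (a b c : R) :
    C12b (a ^ 2 * b ^ 2 * c ^ 3) (a * b * c ^ 2) (a * b ^ 2 * c ^ 2) = a ^ 9 * b ^ 12 * c ^ 18 * G a b c := by
  unfold C12b G; ring

/-- `E₂ ∩ St(C12b)` is the tripled curve `Γ̄ = {a + 1 = 0}`: transversal type `u³ + A t⁶` along `Γ`. -/
theorem G_on_E2 (a b : R) : G a b 0 = (a + 1) ^ 3 := by
  unfold G; ring

/-- first Γ-round: blow up `Γ = V(a + 1, c)`, chart `a + 1 = u₁ c`. -/
def G₁ (u₁ b c : R) : R :=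
  u₁ ^ 3 + c ^ 3 * ((u₁ * c - 1) ^ 7 * b ^ 4 + (u₁ * c - 1) ^ 3 + (u₁ * c - 1) ^ 3 * b ^ 12)
    + (u₁ * c - 1) ^ 4 * b * c ^ 4

theorem G_blowup_Gamma (u₁ b c : R) : G (u₁ * c - 1) b c = c ^ 3 * G₁ u₁ b c := by
  unfold G G₁; ring

/-- the new exceptional divisor `E_Γ = {c = 0}` meets the strict transform in the TRIPLED curve `Γ₁ = {u₁ = 0}`:
the nested hosted section (second `(HR)` round, `NESTSTUCK = 2` in the walker). -/
theorem G₁_on_EGamma (u₁ b : R) : G₁ u₁ b 0 = u₁ ^ 3 := by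
  unfold G₁; ring

/-- second Γ-round: blow up `Γ₁ = V(u₁, c)`, chart `u₁ = u₂ c`. -/
def G₂ (u₂ b c : R) : R :=
  u₂ ^ 3 + ((u₂ * c ^ 2 - 1) ^ 7 * b ^ 4 + (u₂ * c ^ 2 - 1) ^ 3 + (u₂ * c ^ 2 - 1) ^ 3 * b ^ 12)
    + (u₂ * c ^ 2 - 1) ^ 4 * b * c

theorem G₁_blowup_Gamma₁ (u₂ b c : R) : G₁ (u₂ * c) b c = c ^ 3 * G₂ u₂ b c := by
  unfold G₁ G₂; ring

/-- after the second round the exceptional curve is `u₂³ = 1 + b⁴ + b¹²` — reduced (a cubic cover of the `b`-line),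
no further tripled curve: the tower over `Γ` has exactly two rounds, `T(3,6) = S₃ S₃`. -/
theorem G₂_on_EGamma₁ (u₂ b : R) : G₂ u₂ b 0 = u₂ ^ 3 - (1 + b ^ 4 + b ^ 12) := by
  unfold G₂; ring

/-- generic smoothness of that curve away from `3 = 0`: where `u₂ ≠ 0` the `u₂`-derivative `3u₂²` is a unit times `u₂²`;
recorded as the factorisation of the derivative only. -/
example (u₂ : R) : 3 * u₂ ^ 2 = u₂ * (3 * u₂) := by ring

end chart

/-! ## Part C — the first PAIR inside a tower: `Q16b = (x²+y²z)⁴ + x¹⁰ + y¹⁶ + z¹⁶ + x·y¹⁵` (μ = 4, ν = 6, `T(4,6) = S₄ S₂ P₂`)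

Same cone `⟨E₁,E₅,E₂⟩` and monomial map as Part B; total transform `a¹² b¹⁶ c²⁴ · H`, `H|_{E₂} = (a+1)⁴`, transversal type
`u⁴ + b⁴·t⁶` along `Γ̄ = {a = -1}`.  Round 1 (section, `a + 1 = u₁c`): `H₁|_{E_{C₁}} = u₁⁴` but the strict transform has
multiplicity only 2 along `C₂ = V(u₁, c)` (lowest term `b⁴c²`): a FREE double curve — round 2 is a nested SECTION.  Round 2 in the
chart `c = c₂u₁` (the one that sees the satellite): `H₂|_{E_{C₂}} = b⁴c₂²` and `H₂|_{St E_{C₁}} = u₁²` — the new double curve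
`C₃ = V(u₁, c₂) = E_{C₂} ∩ St(E_{C₁})` lies on TWO exceptional members: a SATELLITE point of the transversal germ, i.e. a PAIR round
`(E_{C₁}, E_{C₂})` whose members are both (HR)-born.  Round 3 (`u₁ = u₃c₂`): `H₃|_{exc} = u₃² + b⁴`, reduced — the tower stops:
`S₄ S₂ P₂` over the generic point of `Γ̄`.  CAVEAT (R20b, kit j321689): for THIS customer the `t⁶`-coefficient `a⁸b⁴` vanishes at both closure
points of `Γ̄` (`b = 0` here; order 8 at the `E_(4,3,2)` end), so `H₃` is still singular along the curve `{u₃ = b = 0}` (`H₃_secondary_curve`)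
and the walker's word continues with a secondary tower (`pair(E4,E7) · pair(E7,E9) …`) — the clean, closure-uniform customer is `Q16i` of Part D. -/

section quartic
variable {R : Type*} [CommRing R]

/-- the quartic umbrella customer `Q16b` -/
def Q16b (x y z : R) : R := (x ^ 2 + y ^ 2 * z) ^ 4 + x ^ 10 + y ^ 16 + z ^ 16 + x * y ^ 15

/-- its strict transform in the chart `x = a²b²c³, y = abc², z = ab²c²` -/
def H (a b c : R) : R := (a + 1) ^ 4 + c ^ 6 * (a ^ 8 * b ^ 4) + c ^ 8 * (a ^ 4 + a ^ 4 * b ^ 16) + a ^ 5 * b * c ^ 9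

theorem Q16b_chart (a b c : R) :
    Q16b (a ^ 2 * b ^ 2 * c ^ 3) (a * b * c ^ 2) (a * b ^ 2 * c ^ 2) = a ^ 12 * b ^ 16 * c ^ 24 * H a b c := by
  unfold Q16b H; ring

/-- `E₂ ∩ St(Q16b) = 4·Γ̄`. -/
theorem H_on_E2 (a b : R) : H a b 0 = (a + 1) ^ 4 := by
  unfold H; ring

/-- round 1 (hosted section at `Γ`): chart `a + 1 = u₁ c`. -/
def H₁ (u₁ b c : R) : R :=
  u₁ ^ 4 + (u₁ * c - 1) ^ 8 * b ^ 4 * c ^ 2 + ((u₁ * c - 1) ^ 4 + (u₁ * c - 1) ^ 4 * b ^ 16) * c ^ 4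
    + (u₁ * c - 1) ^ 5 * b * c ^ 5

theorem H_blowup_Gamma (u₁ b c : R) : H (u₁ * c - 1) b c = c ^ 4 * H₁ u₁ b c := by
  unfold H H₁; ring

theorem H₁_on_EC₁ (u₁ b : R) : H₁ u₁ b 0 = u₁ ^ 4 := by
  unfold H₁; ring

/-- round 2 (nested section at the FREE double curve `C₂ = V(u₁, c)`), in the chart `c = c₂ u₁` that sees the satellite. -/
def H₂ (u₁ b c₂ : R) : R :=
  u₁ ^ 2 + (u₁ ^ 2 * c₂ - 1) ^ 8 * b ^ 4 * c₂ ^ 2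
    + ((u₁ ^ 2 * c₂ - 1) ^ 4 + (u₁ ^ 2 * c₂ - 1) ^ 4 * b ^ 16) * c₂ ^ 4 * u₁ ^ 2
    + (u₁ ^ 2 * c₂ - 1) ^ 5 * b * c₂ ^ 5 * u₁ ^ 3

theorem H₁_blowup_C₂ (u₁ b c₂ : R) : H₁ u₁ b (c₂ * u₁) = u₁ ^ 2 * H₂ u₁ b c₂ := by
  unfold H₁ H₂; ring

/-- on the new exceptional `E_{C₂} = {u₁ = 0}` the strict transform cuts the DOUBLED curve `{c₂ = 0}` … -/
theorem H₂_on_EC₂ (b c₂ : R) : H₂ 0 b c₂ = b ^ 4 * c₂ ^ 2 := by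
  unfold H₂; ring

/-- … and on the strict transform of `E_{C₁}` (`= {c₂ = 0}`) it cuts the doubled curve `{u₁ = 0}`: the next centre
`C₃ = V(u₁, c₂) = E_{C₂} ∩ St(E_{C₁})` is presented by the PAIR of the two (HR)-born exceptionals (a satellite point). -/
theorem H₂_on_EC₁ (u₁ b : R) : H₂ u₁ b 0 = u₁ ^ 2 := by
  unfold H₂; ring

/-- round 3 (the pair round at `C₃`): chart `u₁ = u₃ c₂`. -/
def H₃ (u₃ b c₂ : R) : R :=
  u₃ ^ 2 + (u₃ ^ 2 * c₂ ^ 3 - 1) ^ 8 * b ^ 4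
    + ((u₃ ^ 2 * c₂ ^ 3 - 1) ^ 4 + (u₃ ^ 2 * c₂ ^ 3 - 1) ^ 4 * b ^ 16) * c₂ ^ 4 * u₃ ^ 2
    + (u₃ ^ 2 * c₂ ^ 3 - 1) ^ 5 * b * c₂ ^ 6 * u₃ ^ 3

theorem H₂_blowup_C₃ (u₃ b c₂ : R) : H₂ (u₃ * c₂) b c₂ = c₂ ^ 2 * H₃ u₃ b c₂ := by
  unfold H₂ H₃; ring

/-- after the pair round the exceptional curve is `u₃² + b⁴ = 0` — reduced (two sheets `u₃ = ± i b²` over `k̄`, `p ≠ 2`):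
the tower over `Γ` is `S₄ S₂ P₂ = T(4,6)`. -/
theorem H₃_on_exc (u₃ b : R) : H₃ u₃ b 0 = u₃ ^ 2 + b ^ 4 := by
  unfold H₃; ring

/-- over the closure point `b = 0` the strict transform after the tower still CONTAINS the curve `{u₃ = b = 0}` (and is singular
there: `H₃ = u₃² + a⁸b⁴ + …`): the secondary tower of R20b. -/
theorem H₃_secondary_curve (c₂ : R) : H₃ 0 0 c₂ = 0 := by
  unfold H₃; ring

/-- the generic-point count for a `T(4,6)` customer with 5 toric pairs (attained by the closure-uniform `Q16i`, Part D; for `Q16b`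
the secondary towers at the two closure ends add to it). -/
theorem wordLength_Q16b : wordLength 5 [(4, 6)] = 9 := by decide

/-- R20c (kit j321783, measured AFTER the fact, then read as a law): for `Q16b` the two NON-uniform closure ends (`t⁶`-coefficient
`a⁸b⁴`: order `k = 4` at the `E_(2,1,2)`-end, `k = 8` at the `E_(4,3,2)`-end) each add the Euclid tower `T(2,k)` of the residual
plane germ `u₃² + s^k` — played by the walker as PAIR rounds `pair(E_end, E_{C₂})`, `pair(E_{C₂}, E_new)`, … — so the word length is
`1 + 5 + |T(4,6)| + |T(2,8)| + |T(2,4)| = 15`, the length of all three closing words found. -/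
theorem wordLength_Q16b_with_ends : wordLength 5 [(4, 6), (2, 8), (2, 4)] = 15 := by decide

end quartic

/-! ## Part D — the closure-UNIFORM quartic customer `Q16i = (x²+y²z)⁴ + x¹⁰ + y¹⁶ + z¹⁶ + x²y¹² + x²z¹²` (R20c)

The extra tail monomials `x²y¹² ↦ a⁴c⁶` and `x²z¹² ↦ a⁴b¹²c⁶` make the `t⁶`-coefficient `a⁴(1 + b¹² + a⁴b⁴)` a UNIT at both closure
points of `Γ̄` (`b = 0` in this chart, and `1 + a⁸b⁴ + a¹²b¹²` at the `E_(4,3,2)` end — `r20/endcheck.py`).  Same three rounds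
`S₄ S₂ P₂`; after the pair round the exceptional curve is `u₃² + (1 + b⁴ + b¹²)` and NO secondary curve survives over `b = 0`
(`K₃_no_secondary_curve`, contrast `H₃_secondary_curve`).  R20c prediction (kit j321783): `Q16i` closes in exactly `1 + 5 + 3 = 9`. -/

section quarticUniform
variable {R : Type*} [CommRing R]

def Q16i (x y z : R) : R := (x ^ 2 + y ^ 2 * z) ^ 4 + x ^ 10 + y ^ 16 + z ^ 16 + x ^ 2 * y ^ 12 + x ^ 2 * z ^ 12

def K (a b c : R) : R := (a + 1) ^ 4 + c ^ 6 * (a ^ 4 + a ^ 4 * b ^ 12 + a ^ 8 * b ^ 4) + c ^ 8 * (a ^ 4 + a ^ 4 * b ^ 16)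

theorem Q16i_chart (a b c : R) :
    Q16i (a ^ 2 * b ^ 2 * c ^ 3) (a * b * c ^ 2) (a * b ^ 2 * c ^ 2) = a ^ 12 * b ^ 16 * c ^ 24 * K a b c := by
  unfold Q16i K; ring

theorem K_on_E2 (a b : R) : K a b 0 = (a + 1) ^ 4 := by
  unfold K; ring

/-- round 1: `a + 1 = u₁ c`. -/
def K₁ (u₁ b c : R) : R :=
  u₁ ^ 4 + c ^ 2 * ((u₁ * c - 1) ^ 4 + (u₁ * c - 1) ^ 4 * b ^ 12 + (u₁ * c - 1) ^ 8 * b ^ 4)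
    + c ^ 4 * ((u₁ * c - 1) ^ 4 + (u₁ * c - 1) ^ 4 * b ^ 16)

theorem K_blowup_Gamma (u₁ b c : R) : K (u₁ * c - 1) b c = c ^ 4 * K₁ u₁ b c := by
  unfold K K₁; ring

theorem K₁_on_EC₁ (u₁ b : R) : K₁ u₁ b 0 = u₁ ^ 4 := by
  unfold K₁; ring

/-- round 2 (free double section), satellite chart `c = c₂ u₁`. -/
def K₂ (u₁ b c₂ : R) : R :=
  u₁ ^ 2 + c₂ ^ 2 * ((u₁ ^ 2 * c₂ - 1) ^ 4 + (u₁ ^ 2 * c₂ - 1) ^ 4 * b ^ 12 + (u₁ ^ 2 * c₂ - 1) ^ 8 * b ^ 4)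
    + c₂ ^ 4 * u₁ ^ 2 * ((u₁ ^ 2 * c₂ - 1) ^ 4 + (u₁ ^ 2 * c₂ - 1) ^ 4 * b ^ 16)

theorem K₁_blowup_C₂ (u₁ b c₂ : R) : K₁ u₁ b (c₂ * u₁) = u₁ ^ 2 * K₂ u₁ b c₂ := by
  unfold K₁ K₂; ring

/-- the satellite: the next centre `V(u₁, c₂)` is cut out doubly on `E_{C₂}` … -/
theorem K₂_on_EC₂ (b c₂ : R) : K₂ 0 b c₂ = (1 + b ^ 4 + b ^ 12) * c₂ ^ 2 := by
  unfold K₂; ring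

/-- … and doubly on `St(E_{C₁})`: a PAIR round of two (HR)-born exceptionals. -/
theorem K₂_on_EC₁ (u₁ b : R) : K₂ u₁ b 0 = u₁ ^ 2 := by
  unfold K₂; ring

/-- round 3 (the pair round): `u₁ = u₃ c₂`. -/
def K₃ (u₃ b c₂ : R) : R :=
  u₃ ^ 2 + ((u₃ ^ 2 * c₂ ^ 3 - 1) ^ 4 + (u₃ ^ 2 * c₂ ^ 3 - 1) ^ 4 * b ^ 12 + (u₃ ^ 2 * c₂ ^ 3 - 1) ^ 8 * b ^ 4)
    + c₂ ^ 4 * u₃ ^ 2 * ((u₃ ^ 2 * c₂ ^ 3 - 1) ^ 4 + (u₃ ^ 2 * c₂ ^ 3 - 1) ^ 4 * b ^ 16)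

theorem K₂_blowup_C₃ (u₃ b c₂ : R) : K₂ (u₃ * c₂) b c₂ = c₂ ^ 2 * K₃ u₃ b c₂ := by
  unfold K₂ K₃; ring

/-- after the pair round: exceptional curve `u₃² + (1 + b⁴ + b¹²)` — reduced, and its `b`-coefficient a UNIT at the closure point `b = 0`. -/
theorem K₃_on_exc (u₃ b : R) : K₃ u₃ b 0 = u₃ ^ 2 + (1 + b ^ 4 + b ^ 12) := by
  unfold K₃; ring

/-- no secondary curve over the closure point: `K₃(0, 0, c₂) = 1` (a unit), contrast `H₃_secondary_curve` for `Q16b`. -/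
theorem K₃_no_secondary_curve (c₂ : R) : K₃ 0 0 c₂ = 1 := by
  unfold K₃; ring

end quarticUniform

end Summit.ResolutionOfSingularities.ResolutionOfSingularities.Cruxes.EquisingularLiftNatThree.ToricTowers.R20
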